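import Summits.CriticalPhenomena.PercolationContinuityZ3.Theorems.Transplant.SubgraphAGLine
import Summits.CriticalPhenomena.PercolationContinuityZ3.Theorems.Transplant.SubgraphLocMod
import Summits.CriticalPhenomena.PercolationContinuityZ3.Theorems.Transplant.BoxProdZ2SeedGeom
import Literature.Probability.Percolation.BoundedDegreeCriticalProb
import Literature.Probability.Percolation.BernoulliPercolationProofs
import Literature.Probability.Percolation.CoveringStrictMonotonicityAssembly
import HarnessLib

/-!
# The graph–subgraph strict inequality, I: the setup, the finite-volume model, windows, the local-modification property

builds on p205010 (kernel theorem, internal audit signed; external expert review pending) — nothing in this file uses p205010.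
Lane `prim-bschramm`, seat `prim-bschramm-p4` gen 10 (PART C3, tier 2′ of `P4-GENERAL.md`).  Helper file
(`--supports stmt-CriticalPhenomena-4575 --as helper`).

A `SubStrict.Setup H` is: a locally finite graph `H` of bounded degree on a countable vertex type, a subgraph edge class `EH ⊆ E(H)`
(`H₀ = fromEdgeSet EH`), a root `o`, a monotone exhausting sequence of finite regions `Ω n`, a radius `R`, and for every subgraph edge
`{x, y}` a zone inside `B_H(x, R)` such that AT EVERY PIVOTAL `{x, y}` (for the exit event of `Ω n`, any `n`, any configuration) THERE IS A
ROUTE (`SubLoc.RouteData`) at that zone whose enhancement edge is not in `EH`.  THEOREM `SubStrict.Setup.criticalProb_lt`: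
**`p_c(H₀, o) < 1 ⟹ p_c(H, o) < p_c(H₀, o)`**.  Proof = Aizenman–Grimmett / Menshikov: the two-parameter polynomials `Θ_n(p, s)` of the exit
events over the `H`-edges meeting `Ω n` (`SubAG`), the local-modification property from the routes (windows = edges near `B(x, R+1) ∪ B(y, R+1)`,
uniform cardinality and overlap bounds from the degree bound) — THIS FILE; the differential inequality, the segment and the endpoints
are the sequel `SubgraphStrict`.
[cite: AizenmanGrimmett1991, Thm 1 (essential enhancements)] [cite: Menshikov1987, Thm (graph and subgraph)] [cite: MartineauSevero2019, §6]
-/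

noncomputable section

namespace Summit.CriticalPhenomena.PercolationContinuityZ3.Theorems.Transplant

namespace SubStrict

open MeasureTheory SimpleGraph Literature.Probability.Percolation Literature.Probability.Percolation.ProdWeight
open Literature.Barriers.CriticalPhenomena (graphBall graphBall_finite mem_graphBall_self graphBall_mono)
open SubLoc
open scoped Classical

section Pre

variable {V : Type} {H : SimpleGraph V}

/-- Balls are symmetric. [folklore] -/
theorem mem_graphBall_comm {z w : V} {m : ℕ} (h : w ∈ graphBall H z m) : z ∈ graphBall H w m := by
  obtain ⟨p, hp⟩ := h
  exact ⟨p.reverse, by rw [Walk.length_reverse]; exact hp⟩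

/-- For a configuration inside `E(H)` the `H`-open graph is the open graph. [folklore] -/
theorem og_eq_of_subset {ω : Set (Sym2 V)} (h : ω ⊆ H.edgeSet) : og H ω = openGraph ω := by
  rw [og, Set.inter_eq_left.2 h]; rfl

end Pre

variable {V : Type} (H : SimpleGraph V) [H.LocallyFinite]

/-! ## §1 The setup -/

/-- **SETUP for the graph–subgraph strict inequality**: subgraph edge class, root, exhaustion, degree bound, zone radius, zones, and the
ROUTE PROVIDER at pivotal subgraph edges. [cite: AizenmanGrimmett1991, Thm 1 (essential enhancements)] -/
structure Setup where
  /-- the edges of the subgraph `H₀` -/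
  EH : Set (Sym2 V)
  /-- they are edges of `H` -/
  EH_sub : EH ⊆ H.edgeSet
  /-- the root -/
  o : V
  /-- the exhausting regions -/
  Ω : ℕ → Finset V
  /-- monotone -/
  Ω_mono : ∀ n m, n ≤ m → Ω n ⊆ Ω m
  /-- exhausting -/
  Ω_exh : ∀ v, ∃ n, v ∈ Ω n
  /-- a degree bound -/
  Δ : ℕ
  /-- every vertex has degree `≤ Δ` -/
  degree_le : ∀ v, H.degree v ≤ Δ
  /-- the zone radius -/
  R : ℕ
  /-- the zone of the ordered subgraph edge `(x, y)` -/
  zone : V → V → Set V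
  /-- zones are near their edge -/
  zone_sub : ∀ x y, zone x y ⊆ graphBall H x R
  /-- **the route provider**: at every pivotal subgraph edge a route at its zone with enhancement edge outside `EH` -/
  loc : ∀ (n : ℕ) (x y : V), s(x, y) ∈ EH → ∀ ω : Set (Sym2 V),
    insert s(x, y) ω ∈ exitEv H (↑(Ω n) : Set V) o → ω \ {s(x, y)} ∉ exitEv H (↑(Ω n) : Set V) o →
      ∃ D : RouteData H (ω \ {s(x, y)}) (↑(Ω n) : Set V) (zone x y) o, s(D.a, D.b) ∈ H.edgeSet ∧ s(D.a, D.b) ∉ EH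

namespace Setup

variable {H} (S : Setup H)

/-- The subgraph `H₀`. [folklore] -/
def H₀ : SimpleGraph V := fromEdgeSet S.EH

/-- `H₀ ≤ H`. [folklore] -/
theorem H₀_le : S.H₀ ≤ H := fun a b h => by
  have h' := (fromEdgeSet_adj _).1 h
  exact S.EH_sub h'.1

/-- `E(H₀) = EH`. [folklore] -/
theorem edgeSet_H₀ : S.H₀.edgeSet = S.EH := by
  ext e
  rw [H₀, edgeSet_fromEdgeSet]
  constructor
  · exact fun h => h.1
  · exact fun h => ⟨h, fun hd => H.not_isDiag_of_mem_edgeSet (S.EH_sub h) hd⟩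

/-- `H₀` is locally finite. [folklore] -/
instance instLocallyFiniteH₀ : S.H₀.LocallyFinite := fun v =>
  Set.fintypeSubset (H.neighborSet v) (fun w (hw : S.H₀.Adj v w) => S.H₀_le hw)

/-- The `H`-edges meeting `Ω n` (the coordinates of the finite-volume model). [folklore] -/
def K (n : ℕ) : Finset (Sym2 V) := (S.Ω n).biUnion fun v => H.incidenceFinset v

/-- Membership in `K n`. [folklore] -/
theorem mem_K {n : ℕ} {d : Sym2 V} : d ∈ S.K n ↔ d ∈ H.edgeSet ∧ ∃ v ∈ S.Ω n, v ∈ d := by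
  rw [K, Finset.mem_biUnion]
  constructor
  · rintro ⟨v, hv, hd⟩
    rw [mem_incidenceFinset] at hd
    exact ⟨hd.1, v, hv, hd.2⟩
  · rintro ⟨hd, v, hv, hvd⟩
    exact ⟨v, hv, (mem_incidenceFinset _ _ _).2 ⟨hd, hvd⟩⟩

/-- The subgraph coordinates. [folklore] -/
def KE (n : ℕ) : Finset (Sym2 V) := (S.K n).filter fun d => d ∈ S.EH

/-- The enhancement coordinates. [folklore] -/
def KV (n : ℕ) : Finset (Sym2 V) := (S.K n).filter fun d => d ∉ S.EH

/-- The two classes are disjoint. [folklore] -/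
theorem disjoint_KE_KV (n : ℕ) : Disjoint (S.KE n) (S.KV n) :=
  Finset.disjoint_filter_filter_not _ _ _

/-- The two classes exhaust `K n`. [folklore] -/
theorem mem_KE_or_KV {n : ℕ} {d : Sym2 V} : d ∈ S.K n ↔ d ∈ S.KE n ∨ d ∈ S.KV n := by
  simp only [KE, KV, Finset.mem_filter]
  tauto

/-- The exit event of `Ω n`. [folklore] -/
def A (n : ℕ) : Set (Set (Sym2 V)) := exitEv H (↑(S.Ω n) : Set V) S.o

/-- **The exit event of `Ω n` is determined by the `H`-edges meeting `Ω n`.** [folklore] -/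
theorem determinedBy_A (n : ℕ) : DeterminedBy (S.A n) (↑(S.K n) : Set (Sym2 V)) := by
  rw [determinedBy_iff]
  suffices h : ∀ ω ω' : Set (Sym2 V), ω ∩ ↑(S.K n) = ω' ∩ ↑(S.K n) → ω ∈ S.A n → ω' ∈ S.A n from
    fun ω ω' hωω' => ⟨h ω ω' hωω', h ω' ω hωω'.symm⟩
  rintro ω ω' hωω' ⟨v, hv, ⟨π⟩⟩
  obtain ⟨u, hu, π₁, -, -, hπ₁⟩ := exists_first_hit π {w | w ∉ (↑(S.Ω n) : Set V)} hv
  refine ⟨u, hu, ⟨π₁.transfer _ fun d hd => ?_⟩⟩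
  induction d using Sym2.inductionOn with
  | hf w w' =>
    have hadj := og_adj.1 (π₁.adj_of_mem_edges hd)
    rw [mem_edgeSet]
    refine og_adj.2 ⟨?_, hadj.2⟩
    -- one endpoint lies in `Ω n`, so the edge is a coordinate
    have hK : s(w, w') ∈ S.K n := by
      rw [mem_K]
      refine ⟨hadj.2, ?_⟩
      by_cases hw : w ∈ S.Ω n
      · exact ⟨w, hw, Sym2.mem_mk_left _ _⟩
      · have hwu : w = u := hπ₁ w (π₁.fst_mem_support_of_mem_edges hd) hw
        by_cases hw' : w' ∈ S.Ω n
        · exact ⟨w', hw', Sym2.mem_mk_right _ _⟩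
        · exact absurd (hwu.trans (hπ₁ w' (π₁.snd_mem_support_of_mem_edges hd) hw').symm) hadj.2.ne
    have : s(w, w') ∈ ω ∩ ↑(S.K n) := ⟨hadj.1, hK⟩
    rw [hωω'] at this
    exact this.1

/-- The exit events are measurable. [folklore] -/
theorem measurableSet_A (n : ℕ) : MeasurableSet (S.A n) := (S.determinedBy_A n).measurableSet_of_finset

/-- The exit events decrease along the exhaustion. [folklore] -/
theorem A_antitone : Antitone S.A := by
  intro n m hnm ω ⟨v, hv, hr⟩
  exact ⟨v, fun h => hv (S.Ω_mono n m hnm h), hr⟩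

/-! ## §2 Windows and their bounds -/

/-- The window of the edge `e` at stage `n`: the coordinates with an endpoint within `R + 1` of an endpoint of `e`. [folklore] -/
def W (n : ℕ) (e : Sym2 V) : Finset (Sym2 V) :=
  (S.K n).filter fun d => ∃ w ∈ d, ∃ z ∈ e, w ∈ graphBall H z (S.R + 1)

/-- The uniform window bound `2 Δ (Δ+1)^{R+1}`. [folklore] -/
def N : ℕ := 2 * (S.Δ * (S.Δ + 1) ^ (S.R + 1))

/-- The edges of `H` with an endpoint within `R+1` of a given vertex are at most `Δ (Δ+1)^{R+1}`. [folklore] -/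
theorem card_near_le (z : V) (T : Finset (Sym2 V)) (hT : ∀ d ∈ T, d ∈ H.edgeSet ∧ ∃ w ∈ d, w ∈ graphBall H z (S.R + 1)) :
    T.card ≤ S.Δ * (S.Δ + 1) ^ (S.R + 1) := by
  have hsub : T ⊆ (BoxProdZ2.ballFin H z (S.R + 1)).biUnion fun w => H.incidenceFinset w := by
    intro d hd
    obtain ⟨hdE, w, hwd, hw⟩ := hT d hd
    exact Finset.mem_biUnion.2 ⟨w, (BoxProdZ2.mem_ballFin H).2 hw, (mem_incidenceFinset _ _ _).2 ⟨hdE, hwd⟩⟩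
  refine (Finset.card_le_card hsub).trans ((Finset.card_biUnion_le).trans ?_)
  calc ∑ w ∈ BoxProdZ2.ballFin H z (S.R + 1), (H.incidenceFinset w).card
      ≤ ∑ _w ∈ BoxProdZ2.ballFin H z (S.R + 1), S.Δ := Finset.sum_le_sum fun w _ => by
        rw [card_incidenceFinset_eq_degree]; exact S.degree_le w
    _ = (BoxProdZ2.ballFin H z (S.R + 1)).card * S.Δ := by rw [Finset.sum_const, smul_eq_mul]
    _ ≤ (S.Δ + 1) ^ (S.R + 1) * S.Δ := Nat.mul_le_mul_right _ (BoxProdZ2.card_ballFin_le H S.degree_le z _)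
    _ = S.Δ * (S.Δ + 1) ^ (S.R + 1) := Nat.mul_comm _ _

/-- A finite set of `H`-edges each having an endpoint within `R+1` of one of two vertices has at most `N` elements. [folklore] -/
theorem card_near_two_le (z z' : V) (T : Finset (Sym2 V))
    (hT : ∀ d ∈ T, d ∈ H.edgeSet ∧ ∃ w ∈ d, w ∈ graphBall H z (S.R + 1) ∨ w ∈ graphBall H z' (S.R + 1)) : T.card ≤ S.N := by
  set T₁ := T.filter fun d => ∃ w ∈ d, w ∈ graphBall H z (S.R + 1)
  set T₂ := T.filter fun d => ∃ w ∈ d, w ∈ graphBall H z' (S.R + 1)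
  have hcover : T ⊆ T₁ ∪ T₂ := by
    intro d hd
    obtain ⟨-, w, hwd, hw | hw⟩ := hT d hd
    · exact Finset.mem_union_left _ (Finset.mem_filter.2 ⟨hd, w, hwd, hw⟩)
    · exact Finset.mem_union_right _ (Finset.mem_filter.2 ⟨hd, w, hwd, hw⟩)
  have h1 : T₁.card ≤ S.Δ * (S.Δ + 1) ^ (S.R + 1) :=
    S.card_near_le z T₁ fun d hd => ⟨(hT d (Finset.mem_filter.1 hd).1).1, (Finset.mem_filter.1 hd).2⟩
  have h2 : T₂.card ≤ S.Δ * (S.Δ + 1) ^ (S.R + 1) :=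
    S.card_near_le z' T₂ fun d hd => ⟨(hT d (Finset.mem_filter.1 hd).1).1, (Finset.mem_filter.1 hd).2⟩
  calc T.card ≤ (T₁ ∪ T₂).card := Finset.card_le_card hcover
    _ ≤ T₁.card + T₂.card := Finset.card_union_le _ _
    _ ≤ S.N := by unfold N; omega

/-- **Window bound**: `|W n e| ≤ N` for every edge `e` of `H`. [folklore] -/
theorem card_W_le (n : ℕ) {e : Sym2 V} (he : e ∈ H.edgeSet) : (S.W n e).card ≤ S.N := by
  induction e using Sym2.inductionOn with
  | hf x y =>
    refine S.card_near_two_le x y _ fun d hd => ?_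
    obtain ⟨hdK, w, hwd, z, hz, hw⟩ := Finset.mem_filter.1 hd
    refine ⟨(S.mem_K.1 hdK).1, w, hwd, ?_⟩
    rcases Sym2.mem_iff.1 hz with rfl | rfl
    · exact Or.inl hw
    · exact Or.inr hw

/-- **Overlap bound**: a coordinate lies in at most `N` windows (stated for any finite set of such edges, to be instance-free). [folklore] -/
theorem card_filter_W_le (n : ℕ) (f : Sym2 V) (hf : f ∈ H.edgeSet) (T : Finset (Sym2 V)) (hT : ∀ e ∈ T, e ∈ S.KE n ∧ f ∈ S.W n e) :
    T.card ≤ S.N := by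
  induction f using Sym2.inductionOn with
  | hf a b =>
    refine S.card_near_two_le a b _ fun e he => ?_
    obtain ⟨heK, hW⟩ := hT e he
    obtain ⟨-, w, hw, z, hz, hwz⟩ := Finset.mem_filter.1 hW
    refine ⟨(S.mem_K.1 (Finset.mem_filter.1 heK).1).1, z, hz, ?_⟩
    rcases Sym2.mem_iff.1 hw with rfl | rfl
    · exact Or.inl (mem_graphBall_comm hwz)
    · exact Or.inr (mem_graphBall_comm hwz)

/-! ## §3 The local-modification property from the routes -/

/-- **`LocMod` holds for the finite-volume model at every stage.** [cite: AizenmanGrimmett1991, Lemma 2 (local modification)]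
[cite: BalisterBollobasRiordan2014, §"bond percolation" p. 13] -/
theorem locMod (n : ℕ) : SubAG.LocMod (S.KE n) (S.KV n) (S.A n) (S.W n) := by
  intro e he T hT hpiv
  have hA : IsUpperSet (S.A n) := isUpperSet_exitEv _ _
  obtain ⟨heK, heE⟩ := Finset.mem_filter.1 he
  rw [isPivotal_iff_of_upper hA] at hpiv
  obtain ⟨hin, hout⟩ := hpiv
  induction e using Sym2.inductionOn with
  | hf x y =>
    obtain ⟨D, hfE, hfEH⟩ := S.loc n x y heE ↑T hin hout
    set f : Sym2 V := s(D.a, D.b) with hf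
    have hfK : f ∈ S.K n := S.mem_K.2 ⟨hfE, D.a, D.R₁Ω _ D.R₁.end_mem_support, Sym2.mem_mk_left _ _⟩
    have hfKV : f ∈ S.KV n := Finset.mem_filter.2 ⟨hfK, hfEH⟩
    have haZ : D.a ∈ graphBall H x (S.R + 1) :=
      graphBall_mono H x (Nat.le_succ _) (S.zone_sub x y (D.sub₁ _ D.R₁.end_mem_support))
    have hfW : f ∈ S.W n s(x, y) := Finset.mem_filter.2 ⟨hfK, D.a, Sym2.mem_mk_left _ _, x, Sym2.mem_mk_left _ _, haZ⟩
    set T' : Finset (Sym2 V) := (S.K n).filter fun d => d ∈ D.modify with hT'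
    have hfT' : f ∉ T' := fun h => D.f_not_mem_modify (Finset.mem_filter.1 h).2
    refine ⟨T', fun d hd => (@Finset.mem_union _ (_) _ _ _).2 (S.mem_KE_or_KV.1 (Finset.mem_filter.1 hd).1), ⟨f, hfKV, hfW, ?_⟩, ?_⟩
    · -- `f` is pivotal in `T'`
      rw [isPivotal_iff_of_upper hA]
      have hdet := (determinedBy_iff _ _).1 (S.determinedBy_A n)
      constructor
      · refine (hdet (insert f D.modify) _ ?_).1 D.insert_mem
        ext d
        simp only [Set.mem_inter_iff, Set.mem_insert_iff, Finset.mem_coe, hT', Finset.mem_filter]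
        tauto
      · intro hmem
        refine D.modify_not_mem hout ((hdet _ D.modify ?_).1 hmem)
        ext d
        simp only [Set.mem_inter_iff, Set.mem_sdiff, Set.mem_singleton_iff, Finset.mem_coe, hT', Finset.mem_filter]
        constructor
        · rintro ⟨⟨⟨-, h⟩, -⟩, hK⟩; exact ⟨h, hK⟩
        · rintro ⟨h, hK⟩; exact ⟨⟨⟨hK, h⟩, fun hdf => hfT' (Finset.mem_filter.2 ⟨hdf ▸ hK, hdf ▸ h⟩)⟩, hK⟩
    · -- agreement off the window
      intro i hi' hiW
      have hi : i ∈ S.K n := S.mem_KE_or_KV.2 ((@Finset.mem_union _ (_) _ _ _).1 hi')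
      have hfar : ∀ w ∈ i, w ∉ S.zone x y := fun w hwi hwZ =>
        hiW (Finset.mem_filter.2 ⟨hi, w, hwi, x, Sym2.mem_mk_left _ _, graphBall_mono H x (Nat.le_succ _) (S.zone_sub x y hwZ)⟩)
      have heW : s(x, y) ∈ S.W n s(x, y) :=
        Finset.mem_filter.2 ⟨heK, x, Sym2.mem_mk_left _ _, x, Sym2.mem_mk_left _ _, mem_graphBall_self H x _⟩
      have hix : i ≠ s(x, y) := fun h => hiW (h ▸ heW)
      have key := D.modify_iff_of_not_mem hfar
      rw [hT', Finset.mem_filter]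
      constructor
      · intro hiT
        exact ⟨hi, key.2 ⟨hiT, hix⟩⟩
      · rintro ⟨-, him⟩
        exact (key.1 him).1

end Setup

end SubStrict

end Summit.CriticalPhenomena.PercolationContinuityZ3.Theorems.Transplant

end
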